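import Summits.AtomisticToContinuum.BoseEinsteinCondensation.Theses.BECInsertionCorrector
import Summits.AtomisticToContinuum.BoseEinsteinCondensation.Theorems.StaticResponseBound.Negative.Basic
import Summits.AtomisticToContinuum.BoseEinsteinCondensation.Theorems.BECInsertionCorrectorStaticResponseToHMinusOne
import Summits.AtomisticToContinuum.BoseEinsteinCondensation.Theorems.BECInsertionCorrectorStaticResponseBoundModulationTwoPoint
import Literature.MathematicalPhysics.QuantumManyBody.WeightedCorrector
import HarnessLib

/-!
# The all-states discriminant in ground-state-form language — stub B3

Helper file for the crux `BECInsertionCorrector.StaticResponseBound` (item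
stmt-AtomisticToContinuum-12057), line `stable-fraction-square-completion`: the registered stub
**B3** `stub_groundStateDiscriminant` (brick B3 of the planner's brick library
`Lines/fsum-sector-sandwich.lean`; statement verbatim from the lead skeleton). If `Θ ≥ 0` is a real
periodic trial state attaining the finite periodic ground-state energy `E₀` and the energy-currency
bound `E₀ − B t² ≤ ⟨Ψ,HΨ⟩ + t⟨V_p⟩_Ψ` (`V_p = ∑ⱼ cos(p·xⱼ)`, `p = 2πk/L`, `B ≥ 0`) holds for all `t`
and all finite-energy periodic `Ψ`, then for every real periodic `C¹` Bose-symmetric test `F`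
`(∫ V_p F²|Θ|²)² ≤ 4B (∫ F²|Θ|²) 𝓔_{|Θ|}(F, F)`, `𝓔 = dirichletFormW` — the all-states form of the
support item stmt-AtomisticToContinuum-12060 (`StaticResponseToHMinusOne`), whose landed plumbing
(`Theorems/…StaticResponseToHMinusOne{Envelope,RealForm,EulerLagrange}.lean`) is reused throughout.

Proof. Put `n = ∫F²|Θ|²`, `b = ∫V_pF²|Θ|²`, `D = 𝓔_{|Θ|}(F,F)`. If `n = 0` then `b = 0`
(`|b| ≤ N n`) and both sides vanish. If `n > 0`, the normalised state `Ψ_F = cF|Θ|`, `c² n = 1`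
(`PeriodicTrialState.ofFun`, `b3_exists_mulState`) has finite energy
`⟨Ψ_F,HΨ_F⟩ = E₀ + c² D` (`StaticResponseToHMinusOne.gsRepresentation` with the measurable weight of
`exists_measurable_weight` and minimality of `Θ`), while `⟨V_p⟩_{Ψ_F} = c² b`; the hypothesis at
`Ψ_F` reads `∀ t, 0 − Bt² ≤ c²D + t c²b`, whose discriminant (`Negative.forall_quad_iff`;
`forall_quad_zero_iff` if `B = 0`) `c⁴b² ≤ 4Bc²D` is the claim after multiplication by `n²`.
No new definitions.
-/

namespace Summit.AtomisticToContinuum.BoseEinsteinCondensation.Cruxes.StaticResponseBound.StableFractionSquareCompletion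

open MeasureTheory Filter
open scoped ENNReal NNReal
open Literature.MathematicalPhysics.QuantumManyBody.BoseGas
open Summit.AtomisticToContinuum.BoseEinsteinCondensation.Theses
open Summit.AtomisticToContinuum.BoseEinsteinCondensation.Theorems.StaticResponseBound.Negative
  (forall_quad_iff forall_quad_zero_iff integral_norm_sq_eq_one)
open Summit.AtomisticToContinuum.BoseEinsteinCondensation.Theorems.StaticResponseToHMinusOne
  (exists_measurable_weight gsRepresentation energy_ne_top_of_eq_mul norm_sq_of_eq_mul)
open Summit.AtomisticToContinuum.BoseEinsteinCondensation.Cruxes.StaticResponseBound.UvThomsonForceWave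
  (contDiff_norm_of_real abs_sum_cos_le)

noncomputable section

variable {N : ℕ} {L : ℝ}

/-! ### Elementary tools -/

/-- Discriminant of the family `∀ t, A − Bt² ≤ E + tX` for `B ≥ 0`: `X² ≤ 4B(E − A)` (for `B = 0`
the family forces `X = 0`). [folklore] -/
theorem b3_sq_le_of_forall_quad {A E X B : ℝ} (hB : 0 ≤ B)
    (h : ∀ t : ℝ, A - B * t ^ 2 ≤ E + t * X) : X ^ 2 ≤ 4 * B * (E - A) := by
  rcases hB.eq_or_lt with rfl | hB'
  · obtain ⟨rfl, -⟩ := forall_quad_zero_iff.1 h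
    simp
  · exact (forall_quad_iff hB').1 h

/-- A bounded observable against a continuous nonnegative density on the cell:
`|∫ g h| ≤ M ∫ h` if `|g| ≤ M` and `h ≥ 0`. [folklore] -/
theorem b3_abs_integral_mul_le {g h : Config N → ℝ} (hh : Continuous h)
    (h0 : ∀ X, 0 ≤ h X) {M : ℝ} (hM : ∀ X, |g X| ≤ M) (L : ℝ) :
    |∫ X in cellN N L, g X * h X| ≤ M * ∫ X in cellN N L, h X := by
  have i2 : Integrable (fun X => M * h X) (volume.restrict (cellN N L)) :=
    (integrableOn_cellN hh L).const_mul _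
  calc |∫ X in cellN N L, g X * h X| ≤ ∫ X in cellN N L, |g X * h X| := abs_integral_le_integral_abs
    _ ≤ ∫ X in cellN N L, M * h X :=
        integral_mono_of_nonneg (Eventually.of_forall fun X => abs_nonneg _) i2
          (Eventually.of_forall fun X => by
            dsimp only
            rw [abs_mul, abs_of_nonneg (h0 X)]
            exact mul_le_mul_of_nonneg_right (hM X) (h0 X))
    _ = M * ∫ X in cellN N L, h X := integral_const_mul _ _

/-! ### The normalised state `F|Θ|/‖F|Θ|‖` -/

/-- **The trial state `F|Θ|/‖F|Θ|‖`.** For a real nonnegative periodic trial state `Θ` and a real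
periodic `C¹` Bose-symmetric `F` with `∫_cell F²|Θ|² > 0`, the function `F|Θ|` normalised on the
cell (`PeriodicTrialState.ofFun`) is an admissible periodic trial state of the form `cF|Θ|`.
[folklore] -/
theorem b3_exists_mulState {Θ : PeriodicTrialState N L} (hreal : ∀ X, Θ.ψ X = (‖Θ.ψ X‖ : ℂ))
    {F : Config N → ℝ} (hF : IsPeriodicTest L F)
    (hFsymm : ∀ (σ : Equiv.Perm (Fin N)) (X : Config N), F (X ∘ σ) = F X)
    (hn : 0 < ∫ X in cellN N L, F X ^ 2 * ‖Θ.ψ X‖ ^ 2) :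
    ∃ Ψ : PeriodicTrialState N L, ∃ c : ℝ, ∀ X, Ψ.ψ X = ((c * F X * ‖Θ.ψ X‖ : ℝ) : ℂ) := by
  set ψF : Config N → ℂ := fun X => ((F X * ‖Θ.ψ X‖ : ℝ) : ℂ) with hψF
  have hGc : ContDiff ℝ 1 fun X => F X * ‖Θ.ψ X‖ := hF.1.mul (contDiff_norm_of_real Θ hreal)
  have hC : ContDiff ℝ 1 ψF := Complex.ofRealCLM.contDiff.comp hGc
  have hper : ∀ (X : Config N) (i : Fin N) (a : Fin 3),
      ψF (X + Pi.single i (EuclideanSpace.single a L)) = ψF X := by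
    intro X i a
    simp only [hψF, hF.2 X i a, Θ.periodic X i a]
  have hsymm : ∀ (σ : Equiv.Perm (Fin N)) (X : Config N), ψF (X ∘ σ) = ψF X := by
    intro σ X
    simp only [hψF, hFsymm σ X, Θ.symm σ X]
  have hint : Integrable (fun X => F X ^ 2 * ‖Θ.ψ X‖ ^ 2) (volume.restrict (cellN N L)) :=
    integrableOn_cellN ((hF.continuous.pow 2).mul ((Θ.contDiff.continuous.norm).pow 2)) L
  have hmass : ∫⁻ X in cellN N L, ((‖ψF X‖₊ : ℝ≥0∞)) ^ 2 =
      ENNReal.ofReal (∫ X in cellN N L, F X ^ 2 * ‖Θ.ψ X‖ ^ 2) := by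
    rw [ofReal_integral_eq_lintegral_ofReal hint (Eventually.of_forall fun X => by positivity)]
    refine lintegral_congr fun X => ?_
    rw [coe_nnnorm_sq_eq_ofReal]
    simp only [hψF, Complex.norm_real, Real.norm_eq_abs, sq_abs, mul_pow]
  have h0 : ∫⁻ X in cellN N L, ((‖ψF X‖₊ : ℝ≥0∞)) ^ 2 ≠ 0 := by
    rw [hmass]
    exact (ENNReal.ofReal_pos.2 hn).ne'
  have htop : ∫⁻ X in cellN N L, ((‖ψF X‖₊ : ℝ≥0∞)) ^ 2 ≠ ⊤ :=
    lintegral_cellN_normSq_ne_top hC.continuous L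
  refine ⟨PeriodicTrialState.ofFun ψF hC hper hsymm h0 htop,
    (Real.sqrt (∫⁻ X in cellN N L, ((‖ψF X‖₊ : ℝ≥0∞)) ^ 2).toReal)⁻¹, fun X => ?_⟩
  rw [PeriodicTrialState.ofFun_apply]
  simp only [hψF]
  push_cast
  ring

/-! ### The stub -/

/-- **B3 `stub_groundStateDiscriminant`** (all-states form of stmt-12060; brick B3 of
`Lines/fsum-sector-sandwich.lean`).  If `Θ` is a real non-negative periodic trial state attaining
the finite ground-state energy and the crux's energy-currency bound `E₀ − Bt² ≤ ⟨Ψ,HΨ⟩ + t⟨V_p⟩_Ψ`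
holds for all `t` and all finite-energy `Ψ`, then for every Bose-symmetric periodic test `F`:
`(∫ V_p F²|Θ|²)² ≤ 4B (∫F²|Θ|²) 𝓔_Θ(F)`.  Proof: the trial state `Ψ_F = FΘ/‖FΘ‖`
(`b3_exists_mulState`), the ground-state representation `E_{Ψ_F} − E₀ = 𝓔_Θ(F)/∫F²|Θ|²`
(`StaticResponseToHMinusOne.gsRepresentation` with the measurable weight of
`exists_measurable_weight`), then the discriminant of the quadratic in `t`
(`b3_sq_le_of_forall_quad`); `F` with `∫F²|Θ|² = 0` is trivial (both sides `0`).
[cite: KipnisLandim1999, App. 1 §6 (6.1)] -/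
theorem stub_groundStateDiscriminant :
    ∀ (v : ℝ → ℝ≥0∞) (N : ℕ) (L : ℝ), 0 < L → ∀ (Θ : PeriodicTrialState N L),
      (∀ X, Θ.ψ X = (‖Θ.ψ X‖ : ℂ)) →
      periodicEnergy v Θ = periodicGroundStateEnergy v N L → periodicEnergy v Θ ≠ ⊤ →
      ∀ (k : Fin 3 → ℤ) (B : ℝ), 0 ≤ B →
        (∀ (t : ℝ) (Ψ : PeriodicTrialState N L), periodicEnergy v Ψ ≠ ⊤ →
          (periodicGroundStateEnergy v N L).toReal - B * t ^ 2 ≤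
            (periodicEnergy v Ψ).toReal +
              t * ∫ X in cellN N L,
                (∑ j, Real.cos (2 * Real.pi / L * ∑ i, (k i : ℝ) * X j i)) * ‖Ψ.ψ X‖ ^ 2) →
        ∀ F : Config N → ℝ, IsPeriodicTest L F →
          (∀ (σ : Equiv.Perm (Fin N)) (X : Config N), F (X ∘ σ) = F X) →
          (∫ X in cellN N L,
              (∑ j, Real.cos (2 * Real.pi / L * ∑ i, (k i : ℝ) * X j i)) * F X ^ 2 * ‖Θ.ψ X‖ ^ 2) ^ 2 ≤
            4 * B * (∫ X in cellN N L, F X ^ 2 * ‖Θ.ψ X‖ ^ 2) *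
              dirichletFormW L (fun X => ‖Θ.ψ X‖) F F := by
  intro v N L _hL Θ hreal hE0 hfin k B hB hresp F hF hFsymm
  -- the observable `g = ∑ⱼ cos(p·xⱼ)` as an opaque function
  obtain ⟨g, hg⟩ : ∃ g : Config N → ℝ,
      g = fun X => ∑ j, Real.cos (2 * Real.pi / L * ∑ i, (k i : ℝ) * X j i) := ⟨_, rfl⟩
  have hgX : ∀ X : Config N, (∑ j, Real.cos (2 * Real.pi / L * ∑ i, (k i : ℝ) * X j i)) = g X :=
    fun X => by rw [hg]
  simp only [hgX] at hresp ⊢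
  -- a measurable weight computing all energies, minimality of `Θ`
  obtain ⟨W, hW, -, -, hEW⟩ := exists_measurable_weight v N L
  have hmin : ∀ Ψ : PeriodicTrialState N L, periodicEnergy v Θ ≤ periodicEnergy v Ψ :=
    fun Ψ => hE0 ▸ periodicGroundStateEnergy_le v Ψ
  have hE0r : (periodicGroundStateEnergy v N L).toReal = (periodicEnergy v Θ).toReal := by
    rw [hE0]
  -- boundedness and continuity of the data
  have hgb : ∀ X : Config N, |g X| ≤ N := fun X => by rw [hg]; exact abs_sum_cos_le L k X
  have hΘc : Continuous fun X => ‖Θ.ψ X‖ := Θ.contDiff.continuous.norm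
  -- the three numbers
  set n : ℝ := ∫ X in cellN N L, F X ^ 2 * ‖Θ.ψ X‖ ^ 2 with hn
  set b : ℝ := ∫ X in cellN N L, g X * F X ^ 2 * ‖Θ.ψ X‖ ^ 2 with hb
  set D : ℝ := dirichletFormW L (fun X => ‖Θ.ψ X‖) F F with hD
  have hn0 : 0 ≤ n := integral_nonneg fun X => by positivity
  -- `|b| ≤ N n`
  have hbn : |b| ≤ N * n := by
    have h := b3_abs_integral_mul_le (g := g) (h := fun X => F X ^ 2 * ‖Θ.ψ X‖ ^ 2)
      ((hF.continuous.pow 2).mul (hΘc.pow 2)) (fun X => by positivity) hgb L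
    have e : ∫ X in cellN N L, g X * (F X ^ 2 * ‖Θ.ψ X‖ ^ 2) = b := by
      rw [hb]
      congr 1 with X
      ring
    rwa [e] at h
  rcases hn0.eq_or_lt with hn0' | hnpos
  · -- degenerate test function: both sides vanish
    have hb0 : b = 0 := by
      rw [← hn0', mul_zero] at hbn
      exact abs_nonpos_iff.1 hbn
    rw [hb0, ← hn0']
    simp
  -- the normalised state `Ψ = cF|Θ|`
  obtain ⟨Ψ, c, hΨ⟩ := b3_exists_mulState hreal hF hFsymm hnpos
  have hθ : ContDiff ℝ 1 fun X => c * F X := contDiff_const.mul hF.1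
  have hθper : IsLatticePeriodic L fun X => c * F X := fun X i e => by
    show c * F _ = c * F X
    rw [hF.2 X i e]
  have hθsymm : ∀ (σ : Equiv.Perm (Fin N)) (X : Config N),
      (fun X => c * F X) (X ∘ σ) = (fun X => c * F X) X := fun σ X => by
    simp only [hFsymm σ X]
  have hΨ' : ∀ X, Ψ.ψ X = (((fun X => c * F X) X * ‖Θ.ψ X‖ : ℝ) : ℂ) := fun X => by rw [hΨ X]
  have hne := energy_ne_top_of_eq_mul hW hEW hreal hfin Ψ hθ hΨ'
  -- the ground-state representation: `E_Ψ = E_Θ + c² D`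
  have hgs := gsRepresentation hW hEW hreal hfin hmin Ψ hθ hθper hθsymm hΨ'
  have hDθ : dirichletFormW L (fun X => ‖Θ.ψ X‖) (fun X => c * F X) (fun X => c * F X) =
      c ^ 2 * D := by
    rw [show (fun X => c * F X) = c • F from rfl, dirichletFormW_smul_left,
      dirichletFormW_smul_right, ← hD]
    ring
  rw [hDθ] at hgs
  -- normalisation `c² n = 1` and the observable `∫ g|Ψ|² = c² b`
  have hnorm : c ^ 2 * n = 1 := by
    have h := integral_norm_sq_eq_one Ψ
    simp_rw [norm_sq_of_eq_mul Θ hΨ'] at h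
    rw [← h, hn, ← integral_const_mul]
    congr 1 with X
    ring
  have hgΨ : ∫ X in cellN N L, g X * ‖Ψ.ψ X‖ ^ 2 = c ^ 2 * b := by
    rw [hb, ← integral_const_mul]
    congr 1 with X
    rw [norm_sq_of_eq_mul Θ hΨ' X]
    ring
  -- the hypothesis at `Ψ`, for all `t`, and its discriminant
  have hq : ∀ t : ℝ, 0 - B * t ^ 2 ≤ c ^ 2 * D + t * (c ^ 2 * b) := by
    intro t
    have h := hresp t Ψ hne
    rw [hE0r, hgs, hgΨ] at h
    linarith
  have hdisc := b3_sq_le_of_forall_quad hB hq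
  -- multiply `c⁴ b² ≤ 4 B c² D` by `n²`
  have e : b ^ 2 = (c ^ 2 * b) ^ 2 * n ^ 2 := by
    calc b ^ 2 = b ^ 2 * (c ^ 2 * n) ^ 2 := by rw [hnorm]; ring
      _ = (c ^ 2 * b) ^ 2 * n ^ 2 := by ring
  rw [e]
  calc (c ^ 2 * b) ^ 2 * n ^ 2 ≤ 4 * B * (c ^ 2 * D - 0) * n ^ 2 :=
        mul_le_mul_of_nonneg_right hdisc (sq_nonneg n)
    _ = 4 * B * n * D * (c ^ 2 * n) := by ring
    _ = 4 * B * n * D := by rw [hnorm, mul_one]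

end

end Summit.AtomisticToContinuum.BoseEinsteinCondensation.Cruxes.StaticResponseBound.StableFractionSquareCompletion
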